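import Summits.ResolutionOfSingularities.ResolutionOfSingularities.Theorems.FrobeniusLadderFInjectiveMacaulayficationFedderAtMaximalIdeal
import Summits.ResolutionOfSingularities.ResolutionOfSingularities.Theorems.FrobeniusLadderFInjectiveMacaulayficationWFixAtNonClosedDimTwo
import Mathlib.RingTheory.MvPolynomial.Ideal
import HarnessLib

/-!
# TASK 4b SOUNDNESS KIT (Ω₁ kernel row): from ONE small monomial in the support of a reduced Fedder element to `FullCl p` of a hypersurface chart at a closed point
# (crux `FInjectiveMacaulayfication` stmt-ResolutionOfSingularities-15315, chain w45a; res-L1-w45a-plan-1 RULING R23.2 (2) «stub-1 g14 — TASK 4b SOUNDNESS»; consumer res-L1-w45a-stub-3 TASK 4c,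
# data ✓p694236 `OmegaOneCureFanCert`; seat res-L1-w45a-stub-1 g14)

[OURS · L1 W4.5a] Support file (`--supports stmt-ResolutionOfSingularities-15315 --as helper`); theorems only; unconditional; any field of characteristic `p` (§1–§3). Nothing of the crux is
proved; no census row is asserted; the tag-by-tag soundness theorem `fullCl_pencilChart_of_tag` is NOT in this file (its typed signature is the checkpoint that follows). AI-written
(AI review is weaker than expert review).

THE REDUCTION (how every exit tag of ✓p694236 will be discharged). The pencil chart of the local model is the HYPERSURFACE `Φ = y^{M₁}·W − y^{M₂}·(y^r − y^s)` in `k[y₁..y_n, W]`; at a closed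
point `P′ = (c, w₀)` over the torus orbit `O_Z` (`c_i = 0 ⇔ i ∈ Z`) its maximal ideal is `(y_i − c_i (i ∉ Z), y_i (i ∈ Z), W − w₀)`. FULL at `P′` ⟸ `Φ` prime and `Φ^{p−1} ∉ (aᵢ^p)` (§1,
Fedder sufficiency ✓ `FedderAtMaximalIdeal.stub_fedderAtMaximalIdeal`). Apply the SUBSTITUTION `θ : y_i ↦ c_i (i ∉ Z), y_i ↦ y_i (i ∈ Z), W ↦ W + w₀`: it kills `y_i − c_i` and sends the other
generators to variables, so `Φ^{p−1} ∈ (aᵢ^p) ⇒ θ(Φ)^{p−1} ∈ (y_Z^p, W^p)` (§3); and membership in a monomial ideal is decided on the support (§2): ONE monomial of `θ(Φ)^{p−1}` with all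
`Z ∪ {W}`-exponents `< p` refutes it. The tags of ✓p694236 name that monomial («unitriangular in the `W`-degree `j`»; p-free exponent arithmetic on `M₁, M₂, r, s`).
* §1 ★ `hypersurface_fullCl_stalk_of_fedder` — `Φ` prime, `y` closed, `𝔪_y ∩ k[Y] = (a₁..a_{m′})`, `Φ^{p−1} ∉ (aᵢ^p)` ⇒ `FullCl p 𝒪_{V(Φ), y}`.
* §2 `not_mem_span_X_pow_of_support` — a polynomial with a support monomial `d`, `d j < p` for all `j ∈ T`, is not in `(X_j^p : j ∈ T)`.
* §3 `map_span_pow_le_of_generators`, ★ `pow_not_mem_of_reduction` — for a ring map `θ` sending every `aᵢ` to `0` or to some `X_j` (`j ∈ T`): a small support monomial of `θ(Φ)^{p−1}` gives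
  `Φ^{p−1} ∉ (aᵢ^p)`; ★★ `hypersurface_fullCl_stalk_of_reduction` = §1 + §3.
[cite: Fedder1983, Prop. 1.7 and Thm. 1.12]
-/

set_option linter.dupNamespace false

noncomputable section

open AlgebraicGeometry IsLocalRing MvPolynomial
open scoped Pointwise

namespace Summit.ResolutionOfSingularities.ResolutionOfSingularities.Theorems.FInjectiveMacaulayfication.PencilExitSoundnessKit

open Summit.ResolutionOfSingularities.ResolutionOfSingularities.Theorems.FInjectiveMacaulayfication
open SliceableCentre

variable (k : Type) [Field k]

/-! ## §1 ★ FULL of a hypersurface at a certified closed point -/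

/-- ★ **A HYPERSURFACE IS FULL AT A CLOSED POINT CARRYING A FEDDER CERTIFICATE**: `Φ ∈ k[Y₁..Y_m]` prime, `y` a closed point of `V(Φ)` with `𝔪_y ∩ k[Y] = (a₁, …, a_{m′})`,
`Φ^{p−1} ∉ (a₁^p, …, a_{m′}^p)` ⇒ `𝒪_{V(Φ), y}` is `FullCl p` (domain ∧ the crux's stalk clause). [cite: Fedder1983, Prop. 1.7 and Thm. 1.12] -/
theorem hypersurface_fullCl_stalk_of_fedder (p : ℕ) [Fact p.Prime] [CharP k p] {m m' : ℕ} (Φ : MvPolynomial (Fin m) k) (hΦ : Prime Φ)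
    (a : Fin m' → MvPolynomial (Fin m) k) (y : Spec (.of (MvPolynomial (Fin m) k ⧸ Ideal.span {Φ}))) (hy : y.asIdeal.IsMaximal)
    (ha : y.asIdeal.comap (Ideal.Quotient.mk (Ideal.span {Φ})) = Ideal.span (Set.range a))
    (hfed : Φ ^ (p - 1) ∉ Ideal.span (Set.range fun i : Fin m' => a i ^ p)) :
    FullCl p ((Spec (.of (MvPolynomial (Fin m) k ⧸ Ideal.span {Φ}))).presheaf.stalk y) := by
  haveI := (Ideal.span_singleton_prime hΦ.ne_zero).mpr hΦ
  haveI : IsDomain (MvPolynomial (Fin m) k ⧸ Ideal.span {Φ}) := Ideal.Quotient.isDomain _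
  haveI := hy
  haveI : IsDomain (Localization.AtPrime y.asIdeal) :=
    IsLocalization.isDomain_of_le_nonZeroDivisors _ y.asIdeal.primeCompl_le_nonZeroDivisors
  have hloc : FullCl p (Localization.AtPrime y.asIdeal) :=
    ⟨inferInstance, FedderAtMaximalIdeal.stub_fedderAtMaximalIdeal p k m m' a Φ y.asIdeal ha hΦ.ne_zero hfed⟩
  exact WFixAtNonClosedDimTwo.fullCl_of_ringEquiv p (Spec.stalkIso (.of _) y).commRingCatIsoToRingEquiv.symm hloc

/-! ## §2 Membership in `(X_j^p : j ∈ T)` is read off the support -/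

/-- **A polynomial with a support monomial all of whose `T`-exponents are `< p` does not lie in `(X_j^p : j ∈ T)`.** [folklore; Mathlib `mem_ideal_span_monomial_image`] -/
theorem not_mem_span_X_pow_of_support (p : ℕ) {σ : Type} (T : Set σ) (Ψ : MvPolynomial σ k) (d : σ →₀ ℕ) (hd : d ∈ Ψ.support)
    (hsmall : ∀ j ∈ T, d j < p) : Ψ ∉ Ideal.span ((fun j : σ => (X j : MvPolynomial σ k) ^ p) '' T) := by
  classical
  have hset : ((fun j : σ => (X j : MvPolynomial σ k) ^ p) '' T) = (fun s : σ →₀ ℕ => monomial s (1 : k)) '' ((fun j : σ => Finsupp.single j p) '' T) := by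
    rw [Set.image_image]
    refine Set.image_congr' fun j => ?_
    rw [X_pow_eq_monomial]
  rw [hset, mem_ideal_span_monomial_image]
  intro h
  obtain ⟨_, ⟨j, hj, rfl⟩, hle⟩ := h d hd
  have := hle j
  rw [Finsupp.single_eq_same] at this
  exact absurd (hsmall j hj) (not_lt.2 this)

/-! ## §3 ★ The reduction -/

/-- **The substitution carries `(aᵢ^p)` into `(X_j^p : j ∈ T)`** when every `θ(aᵢ)` is `0` or a variable `X_j`, `j ∈ T`. [plumbing] -/
theorem map_span_pow_le_of_generators (p : ℕ) (hp : p ≠ 0) {σ τ : Type} {m' : ℕ} (θ : MvPolynomial σ k →+* MvPolynomial τ k) (a : Fin m' → MvPolynomial σ k) (T : Set τ)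
    (hθ : ∀ i, θ (a i) = 0 ∨ ∃ j ∈ T, θ (a i) = X j) :
    (Ideal.span (Set.range fun i : Fin m' => a i ^ p)).map θ ≤ Ideal.span ((fun j : τ => (X j : MvPolynomial τ k) ^ p) '' T) := by
  rw [Ideal.map_span, Ideal.span_le]
  rintro _ ⟨_, ⟨i, rfl⟩, rfl⟩
  rw [SetLike.mem_coe, map_pow]
  rcases hθ i with h0 | ⟨j, hj, hji⟩
  · rw [h0, zero_pow hp]; exact Ideal.zero_mem _
  · rw [hji]; exact Ideal.subset_span ⟨j, hj, rfl⟩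

/-- ★ **FEDDER NON-MEMBERSHIP FROM ONE REDUCED MONOMIAL**: if `θ` sends every `aᵢ` to `0` or to a variable `X_j` (`j ∈ T`) and `θ(Φ)^{p−1}` has a support monomial with all `T`-exponents `< p`,
then `Φ^{p−1} ∉ (aᵢ^p)`. [OURS · the reduction step of TASK 4b] -/
theorem pow_not_mem_of_reduction (p : ℕ) (hp : p ≠ 0) {σ τ : Type} {m' : ℕ} (θ : MvPolynomial σ k →+* MvPolynomial τ k) (a : Fin m' → MvPolynomial σ k) (T : Set τ)
    (hθ : ∀ i, θ (a i) = 0 ∨ ∃ j ∈ T, θ (a i) = X j) (Φ : MvPolynomial σ k) (d : τ →₀ ℕ) (hd : d ∈ (θ Φ ^ (p - 1)).support)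
    (hsmall : ∀ j ∈ T, d j < p) : Φ ^ (p - 1) ∉ Ideal.span (Set.range fun i : Fin m' => a i ^ p) := by
  intro hmem
  have h := map_span_pow_le_of_generators k p hp θ a T hθ (Ideal.mem_map_of_mem θ hmem)
  rw [map_pow] at h
  exact not_mem_span_X_pow_of_support k p T _ d hd hsmall h

/-- ★★ **FULL OF A HYPERSURFACE CHART AT A CLOSED POINT FROM ONE REDUCED MONOMIAL** (§1 + §3): the form in which each exit tag of ✓p694236 is discharged. [OURS; cite: Fedder1983,
Thm. 1.12] -/
theorem hypersurface_fullCl_stalk_of_reduction (p : ℕ) [Fact p.Prime] [CharP k p] {m m' : ℕ} {τ : Type} (Φ : MvPolynomial (Fin m) k) (hΦ : Prime Φ)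
    (a : Fin m' → MvPolynomial (Fin m) k) (y : Spec (.of (MvPolynomial (Fin m) k ⧸ Ideal.span {Φ}))) (hy : y.asIdeal.IsMaximal)
    (ha : y.asIdeal.comap (Ideal.Quotient.mk (Ideal.span {Φ})) = Ideal.span (Set.range a))
    (θ : MvPolynomial (Fin m) k →+* MvPolynomial τ k) (T : Set τ) (hθ : ∀ i, θ (a i) = 0 ∨ ∃ j ∈ T, θ (a i) = X j)
    (d : τ →₀ ℕ) (hd : d ∈ (θ Φ ^ (p - 1)).support) (hsmall : ∀ j ∈ T, d j < p) :
    FullCl p ((Spec (.of (MvPolynomial (Fin m) k ⧸ Ideal.span {Φ}))).presheaf.stalk y) :=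
  hypersurface_fullCl_stalk_of_fedder k p Φ hΦ a y hy ha (pow_not_mem_of_reduction k p (Fact.out : p.Prime).ne_zero θ a T hθ Φ d hd hsmall)

end Summit.ResolutionOfSingularities.ResolutionOfSingularities.Theorems.FInjectiveMacaulayfication.PencilExitSoundnessKit

end
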